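import Literature.Geometry.Lorentzian.ShortPulseTransportJets
import Literature.Geometry.Lorentzian.ShortPulseCylinderData
import Literature.Geometry.Lorentzian.LiMeiCollapsePocket
import Literature.Geometry.Lorentzian.InducedVacuumData
import Literature.Geometry.Lorentzian.InitialDataExtension
import Literature.Geometry.Lorentzian.BilinPullbackPointPush
import Literature.Analysis.Calculus.CkSubstitution
import Mathlib.Analysis.Calculus.ContDiff.Bounds
import HarnessLib

/-!
# Transport of a short-pulse spacetime to near-Schwarzschild cylinder data (Li–Mei §2.2)

J. Li, H. Mei, *A construction of collapsing spacetimes in vacuum*, Comm. Math. Phys. 378 (2020)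
= arXiv:2005.01249, §2.2, p. 8: given the vacuum spacetime of Theorem 2.1 (Christodoulou's
short-pulse evolution, `δ`-close in `C^{k+1}` to the Schwarzschild metric of mass `m₀` in the
region `u + u̲ ≥ −1 − r₀/2`), "we denote this hypersurface [a smooth spacelike extension of the
constant area-radius cylinder `{r = r₀}`, `r₀ ∈ (m₀, 2m₀)`, into the short-pulse / Minkowski
regions] by `H` and the initial data induced on it by `g` by `(ḡ, k̄)` … The closeness to
Schwarzschild metric implies that `‖ḡ − ḡ_{m₀}‖_{C^k} + ‖k̄ − k̄_{m₀}‖_{C^k} ≤ C δ^{1/2}`."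

This file PROVES that implication in the tree's vocabulary — the reduction of the named fact
`LiMei.shortPulseCylinderData` (`ShortPulseCylinderData.lean`: data on `E3`, vacuum on a ball,
`C^k`-close on an annulus to the Schwarzschild cylinder data (4.1)) to its SPACETIME form, the
hypothesis `H` of `shortPulseCylinderData_of_spacetime`: for every mass `M > 0` there are
`0 < r₀ < 2M`, `ℓ > 0` such that for all `ρ₁ ≥ 1`, `k`, `ε > 0` some vacuum Lorentzian metric `g`
on a chart domain `U ⊆ E4` carries a smooth spacelike map `f` of the ball `{‖y‖ < ρ₁ + ℓ} ⊆ E3`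
with smooth timelike unit normal `ν`, which on the annulus `{ρ₁ < ‖y‖}` IS the Kerr–Schild
Schwarzschild cylinder `ψ = schwCylMap r₀ 0` (normal towards decreasing area radius) and along
which the coefficients of `g` are `ε`-close in `C^k` to the Schwarzschild coefficients
`Kerr.bilin M 0` — exactly what Theorem 2.1 + §2.2 provide after transport to the (maximally
extended) Kerr–Schild chart. `H` is NOT vendored as a named fact here (it is the apex result,
Christodoulou 2009 Thm. 16.1/17.1 as used by Li–Mei Thm. 2.1); this file is the honest `C^k`
bookkeeping between the two formulations:

* `jet_closeness` — **the `C^k` estimate** (pure analysis): if the coefficient field `G` is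
  `ε_A`-close in `C^{k+1}` to `Kerr.bilin M 0` along `ψ` on the annulus, then the substituted jets
  `hSubst ∘ (·, jetOf G)`, `kSubst ∘ (·, jetOf G)` (`ShortPulseTransportJets.lean`) are `ε`-close in
  `C^k` to the model ones, uniformly in unit test vectors; `ε_A` depends only on
  `M, r₀, ℓ, ρ₁, k, ε`. Ingredients: the locally-Lipschitz substitution estimate
  `Literature.Analysis.Calculus.exists_norm_iteratedFDeriv_substitution_sub_le` on the compact set
  `{ρ₁ ≤ ‖y‖ ≤ ρ₁ + ℓ} × B̄₁ × B̄₁`, Faà di Bruno bounds for `(G − G_M) ∘ ψ` and `D(G − G_M) ∘ ψ`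
  (`norm_iteratedFDerivWithin_comp_le`), and "partial derivatives are restrictions of total
  derivatives" (`iteratedFDeriv_curry_left_eq_compContinuousLinearMap_inl`).
* `shortPulseCylinderData_of_spacetime` — **the transport**: the induced data `(f^* g, K_ν)` on
  the ball (`PseudoRiemannianMetric.exists_initialDataSet_induced_isVacuumConstraintSolution`,
  vacuum constraints from `Ric(g) = 0`), extended to `E3` by the radial cut-off
  (`InitialDataSet.extendByCutoff`, unchanged on `{‖y‖ ≤ ρ₁ + 3ℓ/4}`), are vacuum on
  `{‖y‖ < ρ₁ + ℓ/2}` and satisfy `NearSchwarzschildCylinder M r₁ r₀ ρ₁ (ρ₁ + ℓ/2) k ε`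
  (`nearSchwarzschildCylinder_iff`), because on the annulus `h = hSubst ∘ jetOf G`,
  `k = kSubst ∘ jetOf G` (`inducedBilin_eq_hSubst`, `secondFundamentalForm_eq_kSubst`) and
  `(ḡ_M, k̄_M) = (hSubst, kSubst) ∘ jetOf G_M` (`gbarRep_eq_hSubst`, `kbarRep_eq_kSubst`).
* `nearSchwarzschildPocket_of_spacetime` — composed with
  `nearSchwarzschildPocket_of_shortPulseCylinderData` (`LiMeiCollapsePocket.lean`).

## References

* J. Li, H. Mei, arXiv:2005.01249, Thm. 2.1, §2.2 (p. 8), (4.1) (key `LiMei2020`).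
* D. Christodoulou, *The formation of black holes in general relativity*, EMS 2009, Thm. 16.1,
  Thm. 17.1 (key `Christodoulou2009`).
* Y. Choquet-Bruhat, *General Relativity and the Einstein Equations*, OUP 2009, Ch. VI, Thm. 3.3
  (key `ChoquetBruhat2009`).
-/

noncomputable section

set_option synthInstance.maxHeartbeats 200000

open Bundle Set Function Filter Manifold TopologicalSpace Module
open scoped Manifold ContDiff Topology RealInnerProductSpace Nat

namespace Literature.Geometry.Lorentzian

namespace LiMei

/-- The space of bilinear forms on `E4` (metric coefficients). -/
local notation "Bil" => E4 →L[ℝ] E4 →L[ℝ] ℝ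

/-- The `1`-jets of metric coefficients: a value and a derivative. -/
local notation "Jet" => (E4 →L[ℝ] E4 →L[ℝ] ℝ) × (E4 →L[ℝ] E4 →L[ℝ] E4 →L[ℝ] ℝ)

/-- The substitution variable `(y, v, w)`: a point of the annulus and two test vectors. -/
local notation "Var" => E3 × (E3 × E3)

/-! ### Shortcut instances (canonical Mathlib instances at the concrete types) -/

/-- Shortcut (canonical instance). -/
local instance instNormedAddCommGroupBilT : NormedAddCommGroup Bil :=
  ContinuousLinearMap.toNormedAddCommGroup

/-- Shortcut (canonical instance). -/
local instance instNormedSpaceBilT : NormedSpace ℝ Bil := ContinuousLinearMap.toNormedSpace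

/-- Shortcut (canonical instance). -/
local instance instNormedAddCommGroupDBilT : NormedAddCommGroup (E4 →L[ℝ] Bil) :=
  ContinuousLinearMap.toNormedAddCommGroup

/-- Shortcut (canonical instance). -/
local instance instNormedSpaceDBilT : NormedSpace ℝ (E4 →L[ℝ] Bil) :=
  ContinuousLinearMap.toNormedSpace

/-- Shortcut (canonical instance). -/
local instance instNormedAddCommGroupJetT : NormedAddCommGroup Jet := Prod.normedAddCommGroup

/-- Shortcut (canonical instance). -/
local instance instNormedSpaceJetT : NormedSpace ℝ Jet := Prod.normedSpace

/-- Shortcut (canonical instance). -/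
local instance instNormedAddCommGroupVarT : NormedAddCommGroup Var := Prod.normedAddCommGroup

/-- Shortcut (canonical instance). -/
local instance instNormedSpaceVarT : NormedSpace ℝ Var := Prod.normedSpace

/-- Shortcut (canonical instance). -/
local instance instNormedAddCommGroupVarJetT : NormedAddCommGroup (Var × Jet) :=
  Prod.normedAddCommGroup

/-- Shortcut (canonical instance). -/
local instance instNormedSpaceVarJetT : NormedSpace ℝ (Var × Jet) := Prod.normedSpace

/-- Shortcut (canonical instance). -/
local instance instNormedAddCommGroupE3BilT : NormedAddCommGroup (E3 × Bil) :=
  Prod.normedAddCommGroup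

/-- Shortcut (canonical instance). -/
local instance instNormedSpaceE3BilT : NormedSpace ℝ (E3 × Bil) := Prod.normedSpace

/-! ### Two generic calculus inequalities -/

section Calculus

variable {E F P : Type*} [NormedAddCommGroup E] [NormedSpace ℝ E] [NormedAddCommGroup F]
  [NormedSpace ℝ F] [NormedAddCommGroup P] [NormedSpace ℝ P]

/-- Precomposition with the first projection does not increase derivative norms: for `f` smooth
on an open `s ∋ x.1`, `‖Dⁱ(f ∘ fst)(x)‖ ≤ ‖Dⁱf(x.1)‖` (`‖fst‖ ≤ 1`). [folklore] -/
theorem norm_iteratedFDeriv_comp_fst_le {f : E → P} {s : Set E} (hs : IsOpen s)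
    (hf : ContDiffOn ℝ ∞ f s) {x : E × F} (hx : x.1 ∈ s) (i : ℕ) :
    ‖iteratedFDeriv ℝ i (fun z : E × F ↦ f z.1) x‖ ≤ ‖iteratedFDeriv ℝ i f x.1‖ := by
  have hpre : IsOpen (ContinuousLinearMap.fst ℝ E F ⁻¹' s) :=
    hs.preimage (ContinuousLinearMap.fst ℝ E F).continuous
  have hxs : ContinuousLinearMap.fst ℝ E F x ∈ s := hx
  have hfun : (fun z : E × F ↦ f z.1) = f ∘ ContinuousLinearMap.fst ℝ E F := rfl
  rw [hfun, ← iteratedFDerivWithin_of_isOpen i hpre hxs,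
    (ContinuousLinearMap.fst ℝ E F).iteratedFDerivWithin_comp_right hf hs.uniqueDiffOn
      hpre.uniqueDiffOn hxs (by exact_mod_cast le_top), iteratedFDerivWithin_of_isOpen i hs hxs]
  refine ((iteratedFDeriv ℝ i f _).norm_compContinuousLinearMap_le _).trans ?_
  have h : ∏ _j : Fin i, ‖ContinuousLinearMap.fst ℝ E F‖ ≤ 1 :=
    Finset.prod_le_one (fun _ _ ↦ norm_nonneg _) fun _ _ ↦ ContinuousLinearMap.norm_fst_le ℝ E F
  exact mul_le_of_le_one_right (norm_nonneg _) h

/-- Partial derivatives are bounded by total derivatives: for `f` smooth on an open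
`s ∋ (x, w)`, `‖Dⁱ(f(·, w))(x)‖ ≤ ‖Dⁱf(x, w)‖`
(`iteratedFDeriv_curry_left_eq_compContinuousLinearMap_inl`, `‖inl‖ ≤ 1`). [folklore] -/
theorem norm_iteratedFDeriv_curry_left_le {f : E × F → P} {s : Set (E × F)} (hs : IsOpen s)
    (hf : ContDiffOn ℝ ∞ f s) {x : E} {w : F} (hx : (x, w) ∈ s) (i : ℕ) :
    ‖iteratedFDeriv ℝ i (fun x' ↦ f (x', w)) x‖ ≤ ‖iteratedFDeriv ℝ i f (x, w)‖ := by
  rw [iteratedFDeriv_curry_left_eq_compContinuousLinearMap_inl hs hf hx i]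
  exact norm_compContinuousLinearMap_inl_le _

end Calculus

/-! ### Jets of coefficient fields: domain, smoothness, and the `C^k` estimate along `ψ` -/

/-- The set where `jetOf G r₀` is smooth for `G` smooth on the open `T`: `{y ≠ 0, ψ y ∈ T}` is
open. [folklore] -/
theorem isOpen_jetDomain {T : Set E4} (hT : IsOpen T) (r₀ : ℝ) :
    IsOpen {y : E3 | y ≠ 0 ∧ schwCylMap r₀ 0 y ∈ T} := by
  have hc : ContinuousOn (schwCylMap r₀ 0) {y : E3 | y ≠ 0} := fun y hy ↦
    (contDiffAt_schwCylMap r₀ 0 hy (n := 0)).continuousAt.continuousWithinAt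
  exact hc.isOpen_inter_preimage isOpen_ne hT

/-- `jetOf G r₀` is smooth on `{y ≠ 0, ψ y ∈ T}` for `G` smooth on the open `T`. [folklore] -/
theorem contDiffOn_jetOf {T : Set E4} (hT : IsOpen T) {G : E4 → Bil} (hG : ContDiffOn ℝ ∞ G T)
    (r₀ : ℝ) : ContDiffOn ℝ ∞ (jetOf G r₀) {y : E3 | y ≠ 0 ∧ schwCylMap r₀ 0 y ∈ T} := by
  rintro y ⟨hy, hyT⟩
  have hψ : ContDiffAt ℝ ∞ (schwCylMap r₀ 0) y := contDiffAt_schwCylMap r₀ 0 hy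
  have h1 : ContDiffAt ℝ ∞ G (schwCylMap r₀ 0 y) := hG.contDiffAt (hT.mem_nhds hyT)
  have h2 : ContDiffAt ℝ ∞ (fderiv ℝ G) (schwCylMap r₀ 0 y) :=
    (hG.fderiv_of_isOpen hT (by simp)).contDiffAt (hT.mem_nhds hyT)
  exact ((h1.comp y hψ).prodMk (h2.comp y hψ)).contDiffWithinAt

/-- The model jet `jetOf (Kerr.bilin M 0) r₀` is smooth off the origin (`0 < r₀`). [folklore] -/
theorem contDiffOn_jetOf_bilin [Kerr.Facts] (M : ℝ) {r₀ : ℝ} (hr₀ : 0 < r₀) :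
    ContDiffOn ℝ ∞ (jetOf (Kerr.bilin M 0) r₀) {y : E3 | y ≠ 0} := by
  have hT : IsOpen {x : E4 | 0 < Kerr.radius 0 x} :=
    isOpen_lt continuous_const (Kerr.continuous_radius 0)
  have hG : ContDiffOn ℝ ∞ (Kerr.bilin M 0) {x : E4 | 0 < Kerr.radius 0 x} := fun x hx ↦
    (Kerr.contDiffAt_bilin M 0 hx).contDiffWithinAt
  refine (contDiffOn_jetOf hT hG r₀).mono fun y hy ↦ ⟨hy, ?_⟩
  rw [mem_setOf_eq, radius_schwCylMap hr₀ 0 hy]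
  exact hr₀

/-- **The `C^k` size of the jet difference along the cylinder.** If `G` is smooth on the open
`T ∋ ψ y` (`y ≠ 0`), the derivatives of `ψ` at `y` of orders `1 ≤ j ≤ k` are `≤ D^j` and those of
`G − g_M` at `ψ y` of orders `≤ k + 1` are `≤ ε_A`, then
`‖Dⁱ(jetOf G − jetOf g_M)(y)‖ ≤ i! ε_A Dⁱ` for `i ≤ k` (Faà di Bruno, `norm_iteratedFDerivWithin_comp_le`,
for `(G − g_M) ∘ ψ` and `D(G − g_M) ∘ ψ`; `‖(A, B)‖ = max ‖A‖ ‖B‖`). [folklore] -/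
theorem norm_iteratedFDeriv_jetOf_sub_le [Kerr.Facts] {T : Set E4} (hT : IsOpen T) {G : E4 → Bil}
    (hG : ContDiffOn ℝ ∞ G T) (M : ℝ) {r₀ : ℝ} (hr₀ : 0 < r₀) {k : ℕ} {D εA : ℝ} {y : E3}
    (hy : y ≠ 0) (hyT : schwCylMap r₀ 0 y ∈ T)
    (hD : ∀ j, 1 ≤ j → j ≤ k → ‖iteratedFDeriv ℝ j (schwCylMap r₀ 0) y‖ ≤ D ^ j)
    (hε : ∀ j ≤ k + 1,
      ‖iteratedFDeriv ℝ j (fun x ↦ G x - Kerr.bilin M 0 x) (schwCylMap r₀ 0 y)‖ ≤ εA)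
    {i : ℕ} (hi : i ≤ k) :
    ‖iteratedFDeriv ℝ i (fun z ↦ jetOf G r₀ z - jetOf (Kerr.bilin M 0) r₀ z) y‖ ≤
      i ! * εA * D ^ i := by
  set t : Set E4 := T ∩ {x | 0 < Kerr.radius 0 x} with ht_def
  have ht : IsOpen t := hT.inter (isOpen_lt continuous_const (Kerr.continuous_radius 0))
  have hG₀t : ContDiffOn ℝ ∞ (Kerr.bilin M 0) t := fun x hx ↦
    (Kerr.contDiffAt_bilin M 0 hx.2).contDiffWithinAt
  set Hc : E4 → Bil := fun x ↦ G x - Kerr.bilin M 0 x with hHc_def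
  have hHc : ContDiffOn ℝ ∞ Hc t := (hG.mono inter_subset_left).sub hG₀t
  have hHc' : ContDiffOn ℝ ∞ (fderiv ℝ Hc) t := hHc.fderiv_of_isOpen ht (by simp)
  set O : Set E3 := {z | z ≠ 0 ∧ schwCylMap r₀ 0 z ∈ t} with hO_def
  have hO : IsOpen O := isOpen_jetDomain ht r₀
  have hyt : schwCylMap r₀ 0 y ∈ t :=
    ⟨hyT, by rw [mem_setOf_eq, radius_schwCylMap hr₀ 0 hy]; exact hr₀⟩
  have hyO : y ∈ O := ⟨hy, hyt⟩
  have hψO : ContDiffOn ℝ ∞ (schwCylMap r₀ 0) O := fun z hz ↦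
    (contDiffAt_schwCylMap r₀ 0 hz.1).contDiffWithinAt
  have hmaps : MapsTo (schwCylMap r₀ 0) O t := fun z hz ↦ hz.2
  -- (1) near `y` the difference of the jets is the jet of the difference
  have hev : (fun z ↦ jetOf G r₀ z - jetOf (Kerr.bilin M 0) r₀ z) =ᶠ[𝓝 y] jetOf Hc r₀ := by
    filter_upwards [hO.mem_nhds hyO] with z hz
    have hdG : DifferentiableAt ℝ G (schwCylMap r₀ 0 z) :=
      (hG.contDiffAt (hT.mem_nhds hz.2.1)).differentiableAt (by simp)
    have hdG₀ : DifferentiableAt ℝ (Kerr.bilin M 0) (schwCylMap r₀ 0 z) :=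
      (Kerr.contDiffAt_bilin M 0 hz.2.2 (n := 1)).differentiableAt one_ne_zero
    simp only [jetOf, Prod.mk_sub_mk, hHc_def]
    rw [fderiv_fun_sub hdG hdG₀]
  rw [(hev.iteratedFDeriv ℝ i).eq_of_nhds]
  -- (2) the jet is a pair
  have hψy : ContDiffAt ℝ ∞ (schwCylMap r₀ 0) y := contDiffAt_schwCylMap r₀ 0 hy
  have hc1 : ContDiffAt ℝ ∞ (fun z ↦ Hc (schwCylMap r₀ 0 z)) y :=
    (hHc.contDiffAt (ht.mem_nhds hyt)).comp y hψy
  have hc2 : ContDiffAt ℝ ∞ (fun z ↦ fderiv ℝ Hc (schwCylMap r₀ 0 z)) y :=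
    (hHc'.contDiffAt (ht.mem_nhds hyt)).comp y hψy
  have hprod : iteratedFDeriv ℝ i (jetOf Hc r₀) y =
      (iteratedFDeriv ℝ i (fun z ↦ Hc (schwCylMap r₀ 0 z)) y).prod
        (iteratedFDeriv ℝ i (fun z ↦ fderiv ℝ Hc (schwCylMap r₀ 0 z)) y) :=
    iteratedFDeriv_prodMk hc1 hc2 (by exact_mod_cast le_top)
  rw [hprod, ContinuousMultilinearMap.opNorm_prod]
  -- (3) Faà di Bruno for both components
  have hDO : ∀ j, 1 ≤ j → j ≤ i → ‖iteratedFDerivWithin ℝ j (schwCylMap r₀ 0) O y‖ ≤ D ^ j := by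
    intro j hj1 hj
    rw [iteratedFDerivWithin_of_isOpen j hO hyO]
    exact hD j hj1 (hj.trans hi)
  have hb1 : ‖iteratedFDeriv ℝ i (fun z ↦ Hc (schwCylMap r₀ 0 z)) y‖ ≤ i ! * εA * D ^ i := by
    have h := norm_iteratedFDerivWithin_comp_le (g := Hc) (f := schwCylMap r₀ 0) (n := i)
      (N := ∞) hHc hψO (by exact_mod_cast le_top) ht.uniqueDiffOn hO.uniqueDiffOn hmaps hyO
      (C := εA) (D := D) (fun j hj ↦ ?_) hDO
    · rw [iteratedFDerivWithin_of_isOpen i hO hyO] at h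
      exact h
    · rw [iteratedFDerivWithin_of_isOpen j ht hyt]
      exact hε j (by omega)
  have hb2 : ‖iteratedFDeriv ℝ i (fun z ↦ fderiv ℝ Hc (schwCylMap r₀ 0 z)) y‖ ≤
      i ! * εA * D ^ i := by
    have h := norm_iteratedFDerivWithin_comp_le (g := fderiv ℝ Hc) (f := schwCylMap r₀ 0)
      (n := i) (N := ∞) hHc' hψO (by exact_mod_cast le_top) ht.uniqueDiffOn hO.uniqueDiffOn hmaps
      hyO (C := εA) (D := D) (fun j hj ↦ ?_) hDO
    · rw [iteratedFDerivWithin_of_isOpen i hO hyO] at h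
      exact h
    · rw [iteratedFDerivWithin_of_isOpen j ht hyt, norm_iteratedFDeriv_fderiv]
      exact hε (j + 1) (by omega)
  exact max_le hb1 hb2

/-! ### The `C^k` estimate: closeness of the coefficients forces closeness of the data -/

set_option maxHeartbeats 400000 in
/-- **`C^{k+1}`-closeness of the metric coefficients along the cylinder forces `C^k`-closeness of
the substituted jets** (the quantitative content of Li–Mei's "the closeness to Schwarzschild metric
implies that `‖ḡ − ḡ_{m₀}‖_{C^k} + ‖k̄ − k̄_{m₀}‖_{C^k} ≤ Cδ^{1/2}`", arXiv:2005.01249, §2.2, p. 8).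
For `0 < r₀ < 2M`, `ℓ > 0`, `ρ₁ ≥ 1`, `k`, `ε > 0` there is `ε_A > 0` such that: whenever `G` is
smooth on an open `T ⊆ E4` containing `ψ y` for all `y` in the annulus `ρ₁ < ‖y‖ < ρ₁ + ℓ`, the
pairs `(y, G(ψ y))` lie in `normalDomain` there, and `‖Dʲ(G − g_M)(ψ y)‖ ≤ ε_A` for `j ≤ k + 1`
on the annulus, then for unit-ball test vectors `v, w` and `i ≤ k` the `i`-th derivatives at every
point of the annulus of `z ↦ hSubst r₀ ((z, v, w), jetOf G r₀ z) − hSubst r₀ ((z, v, w), jetOf g_M r₀ z)`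
and of the same with `kSubst` are `≤ ε` in norm. Proof:
`Literature.Analysis.Calculus.exists_norm_iteratedFDeriv_substitution_sub_le` (twice, on the
compact `{ρ₁ ≤ ‖y‖ ≤ ρ₁ + ℓ} × B̄₁ × B̄₁` with the model jet), `norm_iteratedFDeriv_jetOf_sub_le`,
`norm_iteratedFDeriv_curry_left_le`. [cite: LiMei2020, §2.2] -/
theorem jet_closeness [Kerr.Facts] {M r₀ ℓ ρ₁ : ℝ} (hr₀ : 0 < r₀) (h2M : r₀ < 2 * M)
    (hρ₁ : 1 ≤ ρ₁) (k : ℕ) {ε : ℝ} (hε : 0 < ε) :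
    ∃ εA : ℝ, 0 < εA ∧ ∀ (T : Set E4) (G : E4 → Bil), IsOpen T → ContDiffOn ℝ ∞ G T →
      (∀ y : E3, ρ₁ < ‖y‖ → ‖y‖ < ρ₁ + ℓ → schwCylMap r₀ 0 y ∈ T) →
      (∀ y : E3, ρ₁ < ‖y‖ → ‖y‖ < ρ₁ + ℓ → (y, G (schwCylMap r₀ 0 y)) ∈ normalDomain) →
      (∀ j ≤ k + 1, ∀ y : E3, ρ₁ < ‖y‖ → ‖y‖ < ρ₁ + ℓ →
        ‖iteratedFDeriv ℝ j (fun x ↦ G x - Kerr.bilin M 0 x) (schwCylMap r₀ 0 y)‖ ≤ εA) →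
      ∀ (v w : E3), ‖v‖ ≤ 1 → ‖w‖ ≤ 1 → ∀ i ≤ k, ∀ y : E3, ρ₁ < ‖y‖ → ‖y‖ < ρ₁ + ℓ →
        ‖iteratedFDeriv ℝ i (fun z ↦ hSubst r₀ ((z, (v, w)), jetOf G r₀ z) -
            hSubst r₀ ((z, (v, w)), jetOf (Kerr.bilin M 0) r₀ z)) y‖ ≤ ε ∧
        ‖iteratedFDeriv ℝ i (fun z ↦ kSubst r₀ ((z, (v, w)), jetOf G r₀ z) -
            kSubst r₀ ((z, (v, w)), jetOf (Kerr.bilin M 0) r₀ z)) y‖ ≤ ε := by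
  -- the compact set of substitution variables
  set A : Set E3 := {y | ρ₁ ≤ ‖y‖ ∧ ‖y‖ ≤ ρ₁ + ℓ} with hA_def
  have hAc : IsCompact A := by
    have hAeq : A = Metric.closedBall (0 : E3) (ρ₁ + ℓ) ∩ {y | ρ₁ ≤ ‖y‖} := by
      ext y
      simp only [hA_def, mem_setOf_eq, mem_inter_iff, mem_closedBall_zero_iff]
      tauto
    rw [hAeq]
    exact (isCompact_closedBall _ _).inter_right (isClosed_le continuous_const continuous_norm)
  have hA0 : ∀ y ∈ A, y ≠ 0 := by
    intro y hy h
    rw [h, hA_def, mem_setOf_eq, norm_zero] at hy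
    linarith [hy.1]
  set K : Set Var := A ×ˢ (Metric.closedBall (0 : E3) 1 ×ˢ Metric.closedBall (0 : E3) 1)
    with hK_def
  have hKc : IsCompact K :=
    hAc.prod ((isCompact_closedBall 0 1).prod (isCompact_closedBall 0 1))
  set V₀ : Set Var := {q | q.1 ≠ 0} with hV₀_def
  have hV₀ : IsOpen V₀ := isOpen_ne.preimage continuous_fst
  have hKV₀ : K ⊆ V₀ := fun q hq ↦ hA0 q.1 hq.1
  -- the model jet
  set J₀ : Var → Jet := fun q ↦ jetOf (Kerr.bilin M 0) r₀ q.1 with hJ₀_def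
  have hJ₀ : ContDiffOn ℝ ∞ J₀ V₀ :=
    (contDiffOn_jetOf_bilin M hr₀).comp contDiffOn_fst fun q hq ↦ hq
  -- the substitution estimate, twice
  obtain ⟨δh, hδh, Ch, hCh0, hBh⟩ :=
    Literature.Analysis.Calculus.exists_norm_iteratedFDeriv_substitution_sub_le hKc hV₀ hKV₀ hJ₀ k
      isOpen_hDomain (contDiffOn_hSubst r₀) (fun q hq ↦ mem_hDomain.2 (hKV₀ hq))
  obtain ⟨δk, hδk, Ck, hCk0, hBk⟩ :=
    Literature.Analysis.Calculus.exists_norm_iteratedFDeriv_substitution_sub_le hKc hV₀ hKV₀ hJ₀ k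
      isOpen_kDomain (contDiffOn_kSubst r₀)
      (fun q hq ↦ mem_kDomain.2 ⟨hKV₀ hq, (schwCylNormalRep_eq_unitNormalOf hr₀ h2M (hKV₀ hq)).1⟩)
  -- the derivatives of the cylinder map on `A`
  have hψs : ContDiffOn ℝ ∞ (schwCylMap r₀ 0) {y : E3 | y ≠ 0} := fun y hy ↦
    (contDiffAt_schwCylMap r₀ 0 hy).contDiffWithinAt
  obtain ⟨Θ, hΘ0, hΘ⟩ :=
    Literature.Analysis.Calculus.exists_forall_norm_iteratedFDeriv_le_of_isCompact isOpen_ne hψs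
      hAc hA0 (k + 1)
  set Dm : ℝ := max 1 Θ with hDm_def
  have hDm1 : 1 ≤ Dm := le_max_left _ _
  have hΘD : ∀ y ∈ A, ∀ j, 1 ≤ j → j ≤ k →
      ‖iteratedFDeriv ℝ j (schwCylMap r₀ 0) y‖ ≤ Dm ^ j := fun y hy j hj1 hj ↦
    (hΘ j (by omega) y hy).trans ((le_max_right 1 Θ).trans (le_self_pow₀ hDm1 (by omega)))
  -- the constants
  set CJ : ℝ := k ! * Dm ^ k with hCJ_def
  have hCJ1 : 1 ≤ CJ := by
    have h1 : (1 : ℝ) ≤ k ! := by exact_mod_cast Nat.one_le_iff_ne_zero.2 (Nat.factorial_ne_zero k)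
    have h2 : (1 : ℝ) ≤ Dm ^ k := one_le_pow₀ hDm1
    nlinarith
  have hCJ0 : 0 < CJ := by linarith
  set η : ℝ := min (min δh δk) (min (ε / (Ch + 1)) (ε / (Ck + 1))) with hη_def
  have hη0 : 0 < η :=
    lt_min (lt_min hδh hδk) (lt_min (div_pos hε (by linarith)) (div_pos hε (by linarith)))
  have hηδh : η ≤ δh := (min_le_left _ _).trans (min_le_left _ _)
  have hηδk : η ≤ δk := (min_le_left _ _).trans (min_le_right _ _)
  have hmulε : ∀ {C : ℝ}, 0 ≤ C → η ≤ ε / (C + 1) → C * η ≤ ε := by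
    intro C hC h1
    have h2 : C * η ≤ (C + 1) * η := by nlinarith [hη0.le]
    have h3 : (C + 1) * η ≤ (C + 1) * (ε / (C + 1)) := mul_le_mul_of_nonneg_left h1 (by linarith)
    have h4 : (C + 1) * (ε / (C + 1)) = ε := by field_simp
    linarith
  have hChη : Ch * η ≤ ε := hmulε hCh0 ((min_le_right _ _).trans (min_le_left _ _))
  have hCkη : Ck * η ≤ ε := hmulε hCk0 ((min_le_right _ _).trans (min_le_right _ _))
  refine ⟨η / CJ, div_pos hη0 hCJ0, fun T G hT hG hψT hND hsmall v w hv hw i hi y hy₁ hy₂ ↦ ?_⟩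
  -- the annulus, the jet of `G` and its domain
  set S₁ : Set E3 := {y | ρ₁ < ‖y‖ ∧ ‖y‖ < ρ₁ + ℓ} with hS₁_def
  have hS₁ : IsOpen S₁ :=
    (isOpen_lt continuous_const continuous_norm).inter (isOpen_lt continuous_norm continuous_const)
  have hS₁0 : ∀ z ∈ S₁, z ≠ 0 := fun z hz ↦ hA0 z ⟨hz.1.le, hz.2.le⟩
  set O : Set E3 := {z | z ≠ 0 ∧ schwCylMap r₀ 0 z ∈ T} with hO_def
  have hO : IsOpen O := isOpen_jetDomain hT r₀
  have hS₁O : S₁ ⊆ O := fun z hz ↦ ⟨hS₁0 z hz, hψT z hz.1 hz.2⟩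
  have hjG : ContDiffOn ℝ ∞ (jetOf G r₀) O := contDiffOn_jetOf hT hG r₀
  set V : Set Var := {q | q.1 ∈ S₁} with hV_def
  have hV : IsOpen V := hS₁.preimage continuous_fst
  have hVV₀ : V ⊆ V₀ := fun q hq ↦ hS₁0 q.1 hq
  set S' : Set Var := {q | q.1 ∈ S₁ ∧ ‖q.2.1‖ ≤ 1 ∧ ‖q.2.2‖ ≤ 1} with hS'_def
  have hS'V : S' ⊆ V := fun q hq ↦ hq.1
  have hS'K : S' ⊆ K := fun q hq ↦
    ⟨⟨hq.1.1.le, hq.1.2.le⟩, mem_closedBall_zero_iff.2 hq.2.1, mem_closedBall_zero_iff.2 hq.2.2⟩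
  set J : Var → Jet := fun q ↦ jetOf G r₀ q.1 with hJ_def
  have hJ : ContDiffOn ℝ ∞ J V := hjG.comp contDiffOn_fst fun q hq ↦ hS₁O hq
  -- the jet estimate
  have hJJ₀ : ∀ j ≤ k, ∀ q ∈ S', ‖iteratedFDeriv ℝ j (fun z ↦ J z - J₀ z) q‖ ≤ η := by
    intro j hj q hq
    have hq1 : q.1 ∈ S₁ := hq.1
    have h1 : ‖iteratedFDeriv ℝ j (fun z : Var ↦ J z - J₀ z) q‖ ≤
        ‖iteratedFDeriv ℝ j (fun z ↦ jetOf G r₀ z - jetOf (Kerr.bilin M 0) r₀ z) q.1‖ :=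
      norm_iteratedFDeriv_comp_fst_le (f := fun z ↦ jetOf G r₀ z - jetOf (Kerr.bilin M 0) r₀ z)
        hO (hjG.sub ((contDiffOn_jetOf_bilin M hr₀).mono fun z hz ↦ hz.1)) (hS₁O hq1) j
    have h2 : ‖iteratedFDeriv ℝ j (fun z ↦ jetOf G r₀ z - jetOf (Kerr.bilin M 0) r₀ z) q.1‖ ≤
        j ! * (η / CJ) * Dm ^ j :=
      norm_iteratedFDeriv_jetOf_sub_le hT hG M hr₀ (hS₁0 _ hq1) (hψT _ hq1.1 hq1.2)
        (hΘD q.1 ⟨hq1.1.le, hq1.2.le⟩) (fun j' hj' ↦ hsmall j' hj' q.1 hq1.1 hq1.2) hj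
    have h3 : (j ! : ℝ) * (η / CJ) * Dm ^ j ≤ η := by
      have hjk : (j ! : ℝ) ≤ k ! := by exact_mod_cast Nat.factorial_le hj
      have hDj : Dm ^ j ≤ Dm ^ k := pow_le_pow_right₀ hDm1 hj
      have hηC : 0 ≤ η / CJ := (div_pos hη0 hCJ0).le
      calc (j ! : ℝ) * (η / CJ) * Dm ^ j ≤ k ! * (η / CJ) * Dm ^ k := by
            gcongr
        _ = η := by
            rw [hCJ_def]
            field_simp
    exact h1.trans (h2.trans h3)
  -- the substitution estimates at `(y, v, w)`
  have hq : ((y, (v, w)) : Var) ∈ S' := ⟨⟨hy₁, hy₂⟩, hv, hw⟩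
  have hyV : ((y, (v, w)) : Var) ∈ V := ⟨hy₁, hy₂⟩
  have Hh := hBh J V S' η hV hS'V hS'K hJ hη0.le hηδh hJJ₀ i hi (y, (v, w)) hq
  have Hk := hBk J V S' η hV hS'V hS'K hJ hη0.le hηδk hJJ₀ i hi (y, (v, w)) hq
  -- smoothness of the substituted differences on `V` (for the passage to partial derivatives)
  have hgraph : ContDiffOn ℝ ∞ (fun q : Var ↦ ((q, J q) : Var × Jet)) V := contDiffOn_id.prodMk hJ
  have hgraph₀ : ContDiffOn ℝ ∞ (fun q : Var ↦ ((q, J₀ q) : Var × Jet)) V :=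
    contDiffOn_id.prodMk (hJ₀.mono hVV₀)
  have hFh : ContDiffOn ℝ ∞ (fun q : Var ↦ hSubst r₀ (q, J q) - hSubst r₀ (q, J₀ q)) V := by
    refine ContDiffOn.sub ?_ ?_
    · exact (contDiffOn_hSubst r₀).comp hgraph fun q hq ↦ mem_hDomain.2 (hVV₀ hq)
    · exact (contDiffOn_hSubst r₀).comp hgraph₀ fun q hq ↦ mem_hDomain.2 (hVV₀ hq)
  have hFk : ContDiffOn ℝ ∞ (fun q : Var ↦ kSubst r₀ (q, J q) - kSubst r₀ (q, J₀ q)) V := by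
    refine ContDiffOn.sub ?_ ?_
    · exact (contDiffOn_kSubst r₀).comp hgraph fun q hq ↦
        mem_kDomain.2 ⟨hVV₀ hq, hND q.1 hq.1 hq.2⟩
    · exact (contDiffOn_kSubst r₀).comp hgraph₀ fun q hq ↦
        mem_kDomain.2 ⟨hVV₀ hq, (schwCylNormalRep_eq_unitNormalOf hr₀ h2M (hVV₀ hq)).1⟩
  have eh := norm_iteratedFDeriv_curry_left_le hV hFh hyV i
  have ek := norm_iteratedFDeriv_curry_left_le hV hFk hyV i
  exact ⟨eh.trans (Hh.trans hChη), ek.trans (Hk.trans hCkη)⟩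

/-! ### Representatives of the spacetime objects -/

section Representatives

variable {Uo : Opens E3} {U : Opens E4}

open scoped Classical in
/-- The coefficient field of a metric on a chart domain `U ⊆ E4`, extended by `0` off `U`.
[folklore] -/
def metricCoeff (g : LorentzianMetric 𝓘(ℝ, E4) ∞ U) : E4 → Bil :=
  fun x ↦ if hx : x ∈ U then (g.val ⟨x, hx⟩ : E4 →L[ℝ] E4 →L[ℝ] ℝ) else 0

/-- On `U` the coefficient field is `g`. [folklore] -/
theorem metricCoeff_coe (g : LorentzianMetric 𝓘(ℝ, E4) ∞ U) (x : U) :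
    g.val x = metricCoeff g x := by
  unfold metricCoeff
  rw [dif_pos x.2]

/-- The coefficient field is smooth on `U` (`OpensChart.contDiffAt_repr`). [folklore] -/
theorem contDiffOn_metricCoeff (g : LorentzianMetric 𝓘(ℝ, E4) ∞ U) :
    ContDiffOn ℝ ∞ (metricCoeff g) (U : Set E4) := fun x hx ↦
  (OpensChart.contDiffAt_repr (g := g.toPseudoRiemannianMetric) (G := metricCoeff g)
    (metricCoeff_coe g) ⟨x, hx⟩).contDiffWithinAt

open scoped Classical in
/-- The representative `E3 → E4` of a map `f : Uo → U` of chart domains, extended by `0`.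
[folklore] -/
def frameRep (f : Uo → U) : E3 → E4 := fun y ↦ if hy : y ∈ Uo then (f ⟨y, hy⟩ : E4) else 0

/-- On `Uo` the representative is `f`. [folklore] -/
theorem frameRep_coe (f : Uo → U) (y : Uo) : (f y : E4) = frameRep f y := by
  unfold frameRep
  rw [dif_pos y.2]

open scoped Classical in
/-- The representative `E3 → E4` of a field along `f : Uo → U`, extended by `0`. [folklore] -/
def normalRep {f : Uo → U} (ν : NormalField 𝓘(ℝ, E4) f) : E3 → E4 :=
  fun y ↦ if hy : y ∈ Uo then (ν ⟨y, hy⟩ : E4) else 0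

/-- On `Uo` the representative is `ν`. [folklore] -/
theorem normalRep_coe {f : Uo → U} (ν : NormalField 𝓘(ℝ, E4) f) (y : Uo) :
    ν y = normalRep ν y := by
  unfold normalRep
  rw [dif_pos y.2]

end Representatives

/-! ### The transport -/

/-- The open ball of radius `R` about the origin of `E3`, as a chart domain. [folklore] -/
def ballO (R : ℝ) : Opens E3 := ⟨Metric.ball (0 : E3) R, Metric.isOpen_ball⟩

/-- Membership in `ballO R`. [folklore] -/
theorem mem_ballO {R : ℝ} {y : E3} : y ∈ ballO R ↔ ‖y‖ < R := by
  show y ∈ Metric.ball (0 : E3) R ↔ _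
  rw [mem_ball_zero_iff]

/-- **Li–Mei §2.2, the transport to the tree's data statement.** If for every `M > 0` there are
`0 < r₀ < 2M`, `ℓ > 0` such that for all `ρ₁ ≥ 1`, `k`, `ε > 0` a Lorentzian metric `g` on a
chart domain `U ⊆ E4` with `Ric(g) = 0` along a smooth spacelike map `f : {‖y‖ < ρ₁ + ℓ} → U`,
with timelike unit normal `ν` of smooth lift, agreeing on `{ρ₁ < ‖y‖}` with the Schwarzschild
cylinder `schwCylMap r₀ 0` (normal towards decreasing area radius) and with coefficients
`metricCoeff g` `ε`-close in `C^k` to `Kerr.bilin M 0` along it, exists (the output of Li–Mei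
Thm. 2.1 + §2.2 in the Kerr–Schild chart), then `shortPulseCylinderData` holds (with `ℓ/2`): the induced data, extended by
the radial cut-off, are vacuum on `{‖y‖ < ρ₁ + ℓ/2}` and `ε`-close in `C^k` on
`{ρ₁ < ‖y‖ < ρ₁ + ℓ/2}` to `(ḡ_M, k̄_M)` (`jet_closeness` at order `k + 1`). Li–Mei
arXiv:2005.01249, Thm. 2.1 and §2.2, p. 8. [cite: LiMei2020, §2.2] -/
theorem shortPulseCylinderData_of_spacetime
    (H : ∀ [Kerr.Facts], ∀ M : ℝ, 0 < M → ∃ (r₀ ℓ : ℝ), 0 < r₀ ∧ r₀ < 2 * M ∧ 0 < ℓ ∧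
      ∀ ρ₁ : ℝ, 1 ≤ ρ₁ → ∀ (k : ℕ) (ε : ℝ), 0 < ε →
        ∃ (U : Opens E4) (g : LorentzianMetric 𝓘(ℝ, E4) ∞ U) (f : ballO (ρ₁ + ℓ) → U)
          (ν : NormalField 𝓘(ℝ, E4) f),
          (∀ [g.HasLeviCivita], ∀ y, g.ricci (f y) = 0) ∧
          g.IsSpacelikeImmersion 𝓘(ℝ, E3) f ∧ g.IsUnitNormal 𝓘(ℝ, E3) f ν (-1) ∧
          ContMDiff 𝓘(ℝ, E3) 𝓘(ℝ, E4).tangent ∞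
            (fun y ↦ (TotalSpace.mk' E4 (f y) (ν y) : TangentBundle 𝓘(ℝ, E4) U)) ∧
          (∀ y : ballO (ρ₁ + ℓ), ρ₁ < ‖(y : E3)‖ →
            (f y : E4) = schwCylMap r₀ 0 y ∧ ⟪E4.spatial (ν y), (y : E3)⟫ < 0) ∧
          (∀ i ≤ k, ∀ y : E3, ρ₁ < ‖y‖ → ‖y‖ < ρ₁ + ℓ →
            ‖iteratedFDeriv ℝ i (fun x : E4 ↦ metricCoeff g x - Kerr.bilin M 0 x)
              (schwCylMap r₀ 0 y)‖ ≤ ε)) :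
    shortPulseCylinderData := by
  intro _ M hM
  obtain ⟨r₀, ℓ, hr₀, h2M, hℓ, Hρ⟩ := H M hM
  refine ⟨r₀, ℓ / 2, hr₀, h2M, by linarith, fun r₁ ρ₁ _hr₁ hr₁₀ hρ₁ k ε hε ↦ ?_⟩
  obtain ⟨εA, hεA, core⟩ := jet_closeness (ℓ := ℓ) hr₀ h2M hρ₁ k hε
  obtain ⟨U, g, f, ν, hRic, hfi, hun, hlift, hagree, hclose⟩ := Hρ ρ₁ hρ₁ (k + 1) εA hεA
  haveI : g.HasLeviCivita := PseudoRiemannianMetric.hasLeviCivita _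
  -- the frame data for the identification theorems
  set S : Set E3 := {y | ρ₁ < ‖y‖ ∧ ‖y‖ < ρ₁ + ℓ} with hS_def
  have hS : IsOpen S :=
    (isOpen_lt continuous_const continuous_norm).inter (isOpen_lt continuous_norm continuous_const)
  have hS0 : ∀ y ∈ S, y ≠ 0 := by
    intro y hy h
    rw [h, hS_def, mem_setOf_eq, norm_zero] at hy
    linarith [hy.1]
  have hSb : ∀ y ∈ S, y ∈ ballO (ρ₁ + ℓ) := fun y hy ↦ mem_ballO.2 hy.2
  have hΦS : ∀ y ∈ S, frameRep f y = schwCylMap r₀ 0 y := fun y hy ↦ by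
    rw [← frameRep_coe f ⟨y, hSb y hy⟩]
    exact (hagree ⟨y, hSb y hy⟩ hy.1).1
  have hor : ∀ y : ballO (ρ₁ + ℓ), (y : E3) ∈ S → ⟪(y : E3), E4.spatial (ν y)⟫ < 0 :=
    fun y hy ↦ by rw [real_inner_comm]; exact (hagree y hy.1).2
  have hψU : ∀ y : E3, ρ₁ < ‖y‖ → ‖y‖ < ρ₁ + ℓ → schwCylMap r₀ 0 y ∈ U := fun y h₁ h₂ ↦ by
    rw [← (hagree ⟨y, mem_ballO.2 h₂⟩ h₁).1]
    exact (f _).2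
  have hGd : ∀ y : ballO (ρ₁ + ℓ), (y : E3) ∈ S →
      DifferentiableAt ℝ (metricCoeff g) (schwCylMap r₀ 0 y) := fun y hy ↦
    ((contDiffOn_metricCoeff g).contDiffAt (U.isOpen.mem_nhds (hψU y hy.1 hy.2))).differentiableAt
      (by simp)
  have hND : ∀ y : E3, ρ₁ < ‖y‖ → ‖y‖ < ρ₁ + ℓ →
      ((y, metricCoeff g (schwCylMap r₀ 0 y)) : E3 × Bil) ∈ normalDomain := fun y h₁ h₂ ↦
    (mem_normalDomain_and_eq_unitNormalOf g (metricCoeff g) (metricCoeff_coe g) (frameRep_coe f)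
      (normalRep_coe ν) hfi hun hS hS0 hΦS hor ⟨y, mem_ballO.2 h₂⟩ ⟨h₁, h₂⟩).1
  -- the induced data on the ball and their cut-off extension
  obtain ⟨D₀, hD₀h, hD₀k, hD₀vac⟩ :=
    g.toPseudoRiemannianMetric.exists_initialDataSet_induced_isVacuumConstraintSolution hfi hun
      hlift (m := 3) finrank_euclideanSpace_fin (by rw [finrank_euclideanSpace_fin])
      (fun y ↦ hRic y)
  have hσ₁ : (0 : ℝ) ≤ ρ₁ + 3 * ℓ / 4 := by linarith
  have hσ₁₂ : ρ₁ + 3 * ℓ / 4 < ρ₁ + 7 * ℓ / 8 := by linarith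
  have hUσ : ∀ y : E3, ‖y‖ ≤ ρ₁ + 7 * ℓ / 8 → y ∈ ballO (ρ₁ + ℓ) := fun y hy ↦
    mem_ballO.2 (by linarith)
  refine ⟨D₀.extendByCutoff hσ₁ hσ₁₂ hUσ, ?_, ?_⟩
  · -- vacuum on the smaller ball
    intro inst y hy
    exact D₀.isVacuumOn_extendByCutoff hσ₁ hσ₁₂ hUσ hD₀vac y
      (by simp only [mem_setOf_eq] at hy ⊢; linarith)
  · -- closeness on the annulus
    rw [nearSchwarzschildCylinder_iff hr₁₀ hr₀ h2M hρ₁]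
    intro v w hv hw i hi y hy₁ hy₂
    obtain ⟨Hh, Hk⟩ := core (U : Set E4) (metricCoeff g) U.isOpen (contDiffOn_metricCoeff g) hψU
      hND hclose v w hv hw i hi y hy₁ (by linarith)
    -- the neighbourhood of `y` on which the data ARE the substituted jets
    have hN : ∀ᶠ z in 𝓝 y, ρ₁ < ‖z‖ ∧ ‖z‖ < ρ₁ + ℓ / 2 :=
      ((isOpen_lt continuous_const continuous_norm).inter
        (isOpen_lt continuous_norm continuous_const)).mem_nhds ⟨hy₁, hy₂⟩
    have e₁ : (fun z : E3 ↦ (D₀.extendByCutoff hσ₁ hσ₁₂ hUσ).h.inner z v w - gbarRep M r₀ z v w)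
        =ᶠ[𝓝 y] fun z ↦ hSubst r₀ ((z, (v, w)), jetOf (metricCoeff g) r₀ z) -
          hSubst r₀ ((z, (v, w)), jetOf (Kerr.bilin M 0) r₀ z) := by
      filter_upwards [hN] with z hz
      have hzS : z ∈ S := ⟨hz.1, by linarith [hz.2]⟩
      have hzσ : ‖z‖ ≤ ρ₁ + 3 * ℓ / 4 := by linarith [hz.2]
      have eD : (D₀.extendByCutoff hσ₁ hσ₁₂ hUσ).h.inner z v w =
          D₀.h.inner ⟨z, hSb z hzS⟩ v w := by
        rw [D₀.extendByCutoff_h_inner_of_norm_le hσ₁ hσ₁₂ hUσ hzσ]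
        rfl
      rw [eD, hD₀h, PseudoRiemannianMetric.inducedBilin_apply,
        inducedBilin_eq_hSubst g (metricCoeff g) (metricCoeff_coe g) (frameRep_coe f) hS hS0 hΦS
          ⟨z, hSb z hzS⟩ hzS v w, gbarRep_eq_hSubst M hr₀ (hS0 z hzS) v w]
    have e₂ : (fun z : E3 ↦ (D₀.extendByCutoff hσ₁ hσ₁₂ hUσ).k z v w - kbarRep M r₀ z v w)
        =ᶠ[𝓝 y] fun z ↦ kSubst r₀ ((z, (v, w)), jetOf (metricCoeff g) r₀ z) -
          kSubst r₀ ((z, (v, w)), jetOf (Kerr.bilin M 0) r₀ z) := by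
      filter_upwards [hN] with z hz
      have hzS : z ∈ S := ⟨hz.1, by linarith [hz.2]⟩
      have hzσ : ‖z‖ ≤ ρ₁ + 3 * ℓ / 4 := by linarith [hz.2]
      have hz1 : z ∈ Kerr.slice 0 1 := by
        rw [Kerr.mem_slice_zero_iff, max_eq_left zero_le_one]
        exact lt_of_le_of_lt hρ₁ hz.1
      have eD : (D₀.extendByCutoff hσ₁ hσ₁₂ hUσ).k z v w = D₀.k ⟨z, hSb z hzS⟩ v w := by
        rw [D₀.extendByCutoff_k_of_norm_le hσ₁ hσ₁₂ hUσ hzσ]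
        rfl
      have eK : D₀.k ⟨z, hSb z hzS⟩ v w =
          g.secondFundamentalForm 𝓘(ℝ, E3) f ν ⟨z, hSb z hzS⟩ v w := by
        rw [← hD₀k ⟨z, hSb z hzS⟩]
        rfl
      have eM : kbarRep M r₀ z v w =
          kSubst r₀ ((z, (v, w)), jetOf (Kerr.bilin M 0) r₀ z) :=
        kbarRep_eq_kSubst hr₀ h2M ⟨z, hz1⟩ v w
      rw [eD, eK, secondFundamentalForm_eq_kSubst g (metricCoeff g) (metricCoeff_coe g)
        (frameRep_coe f) (normalRep_coe ν) hfi hun hS hS0 hΦS hor hGd ⟨z, hSb z hzS⟩ hzS v w, eM]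
    rw [(e₁.iteratedFDeriv ℝ i).eq_of_nhds, (e₂.iteratedFDeriv ℝ i).eq_of_nhds]
    exact ⟨Hh, Hk⟩

/-- **Li–Mei §2.2 ⇒ the collapse pocket.** The spacetime-level output of Li–Mei Thm. 2.1 + §2.2
(hypothesis `H` of `shortPulseCylinderData_of_spacetime`) yields
`LiMei.nearSchwarzschildPocket` (`LiMeiCollapsePocket.lean`), through `shortPulseCylinderData`
and `nearSchwarzschildPocket_of_shortPulseCylinderData`. [cite: LiMei2020, §2.2] -/
theorem nearSchwarzschildPocket_of_spacetime
    (H : ∀ [Kerr.Facts], ∀ M : ℝ, 0 < M → ∃ (r₀ ℓ : ℝ), 0 < r₀ ∧ r₀ < 2 * M ∧ 0 < ℓ ∧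
      ∀ ρ₁ : ℝ, 1 ≤ ρ₁ → ∀ (k : ℕ) (ε : ℝ), 0 < ε →
        ∃ (U : Opens E4) (g : LorentzianMetric 𝓘(ℝ, E4) ∞ U) (f : ballO (ρ₁ + ℓ) → U)
          (ν : NormalField 𝓘(ℝ, E4) f),
          (∀ [g.HasLeviCivita], ∀ y, g.ricci (f y) = 0) ∧
          g.IsSpacelikeImmersion 𝓘(ℝ, E3) f ∧ g.IsUnitNormal 𝓘(ℝ, E3) f ν (-1) ∧
          ContMDiff 𝓘(ℝ, E3) 𝓘(ℝ, E4).tangent ∞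
            (fun y ↦ (TotalSpace.mk' E4 (f y) (ν y) : TangentBundle 𝓘(ℝ, E4) U)) ∧
          (∀ y : ballO (ρ₁ + ℓ), ρ₁ < ‖(y : E3)‖ →
            (f y : E4) = schwCylMap r₀ 0 y ∧ ⟪E4.spatial (ν y), (y : E3)⟫ < 0) ∧
          (∀ i ≤ k, ∀ y : E3, ρ₁ < ‖y‖ → ‖y‖ < ρ₁ + ℓ →
            ‖iteratedFDeriv ℝ i (fun x : E4 ↦ metricCoeff g x - Kerr.bilin M 0 x)
              (schwCylMap r₀ 0 y)‖ ≤ ε)) :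
    nearSchwarzschildPocket :=
  nearSchwarzschildPocket_of_shortPulseCylinderData (shortPulseCylinderData_of_spacetime H)

end LiMei

end Literature.Geometry.Lorentzian

end
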